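import Mathlib
import HarnessLib

/-!
# Milne *ADT* I Prop. 3.8 in the kernel, part 5a: the Herbrand count for a finite module with an endomorphism of finite order —
# `#A^φ` kills `ker(1 + φ + ⋯ + φ^{m−1}) ∕ (φ − 1)A`
# (cell `bsd-stepL`, seat `bsd-stepL-corner3-p2` g10 = WIDTH-LEVER lane B; toward the DISCHARGE of the cite-only Literature fact
# `Milne2006_localTamagawaNumber_smul_unramifiedClass_eq_zero`; `--supports stmt-BirchSwinnertonDyer-21420 --as helper`)

Pure finite-group algebra (no curve): for a finite additive commutative group `A`, an endomorphism `φ` with `φ^m = 1`, and `a ∈ A`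
with vanishing «norm» `N_m a = Σ_{j<m} φ^j a = 0`, the multiple `#ker(φ − 1) • a` lies in the image of `φ − 1`
(`card_ker_sub_id_nsmul_mem_range`; iterates `φ^[j]` rather than powers, to stay in `A →+ A`). Proof (the Herbrand quotient of a
finite cyclic module is `1`): with `D = φ − 1`, `T = Σ_{j<m} φ^j` one has `T D = D T = φ^m − 1 = 0` (telescoping), so `im D ≤ ker T`,
`im T ≤ ker D`; counting `#A = #ker D · #im D = #ker T · #im T` gives `[ker T : im D] · #im T = #ker D`, so the exponent of
`ker T ∕ im D` divides `#ker D`. USE (part 5b): `A = Φ̃ = E(K_v^{nr})/E₀(K_v^{nr})` (finite by Kodaira–Néron over `K_v^{nr}`),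
`φ` = Frobenius, `#ker(φ − 1) = #Φ̃^{Frob} = c_v` (Lang–Néron, part 4), `a` = the class of the value at Frobenius of an unramified
cocycle (its norm vanishes by continuity).
HONEST FRAMING: finite-group bookkeeping; no definition, no named fact, no `sorry`; nothing about BSD (T7).
References: [cite: SerreLocalFields1979, VIII §4 Prop. 8 (h(A) = 1 for finite A)] [cite: MilneADT2006, Ch. I Prop. 3.8].
-/

set_option linter.dupNamespace false
set_option autoImplicit false

namespace Summit.BirchSwinnertonDyer.BirchSwinnertonDyer.Theorems.MilneTamagawa

open Finset Function

/-- In a finite additive group, `Nat.card (H ⧸ L|_H) · Nat.card L = Nat.card H` for `L ≤ H` (Lagrange). [folklore] -/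
theorem card_quotient_addSubgroupOf_mul_card {A : Type*} [AddCommGroup A] [Finite A] {L H : AddSubgroup A}
    (hLH : L ≤ H) : Nat.card (H ⧸ L.addSubgroupOf H) * Nat.card L = Nat.card H := by
  rw [← Nat.card_congr (AddSubgroup.addSubgroupOfEquivOfLe hLH).toEquiv]
  exact (AddSubgroup.card_eq_card_quotient_mul_card_addSubgroup (L.addSubgroupOf H)).symm

/-- The «norm» `x ↦ Σ_{j<m} φ^[j] x` of an endomorphism, as an additive homomorphism. [folklore] -/
theorem exists_normHom {A : Type*} [AddCommGroup A] (φ : A →+ A) (m : ℕ) :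
    ∃ T : A →+ A, ∀ x, T x = ∑ j ∈ range m, φ^[j] x :=
  ⟨{ toFun := fun x ↦ ∑ j ∈ range m, φ^[j] x
     map_zero' := by simp [iterate_map_zero]
     map_add' := fun x y ↦ by simp [iterate_map_add, sum_add_distrib] }, fun _ ↦ rfl⟩

/-- **Herbrand count for a finite module.** Let `A` be a finite additive commutative group, `φ : A →+ A` with `φ^[m] = id`, and
`a ∈ A` with `Σ_{j<m} φ^[j] a = 0`. Then `(Nat.card (ker (φ − id))) • a ∈ range (φ − id)`.
[cite: SerreLocalFields1979, VIII §4 Prop. 8 (h(A) = 1 for finite A)] -/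
theorem card_ker_sub_id_nsmul_mem_range {A : Type*} [AddCommGroup A] [Finite A]
    (φ : A →+ A) {m : ℕ} (hφm : ∀ x, φ^[m] x = x) {a : A}
    (hNa : ∑ j ∈ range m, φ^[j] a = 0) :
    Nat.card (AddMonoidHom.ker (φ - AddMonoidHom.id A)) • a ∈
      AddMonoidHom.range (φ - AddMonoidHom.id A) := by
  classical
  set D : A →+ A := φ - AddMonoidHom.id A with hD
  have hDapply : ∀ x, D x = φ x - x := fun x ↦ by rw [hD, AddMonoidHom.sub_apply, AddMonoidHom.id_apply]
  obtain ⟨T, hT⟩ := exists_normHom φ m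
  -- telescoping: `T (φ x - x) = φ^[m] x - x = 0` and `φ (T x) - T x = 0`
  have htel : ∀ x, ∑ j ∈ range m, (φ^[j] (φ x) - φ^[j] x) = 0 := fun x ↦ by
    have h := Finset.sum_range_sub (fun j ↦ φ^[j] x) m
    simp only [iterate_zero, id_eq] at h
    rw [hφm x, sub_self] at h
    rw [← h]
    refine Finset.sum_congr rfl fun j _ ↦ ?_
    rw [iterate_succ_apply']
    rw [← iterate_succ_apply, iterate_succ_apply']
  have hTD : ∀ x, T (D x) = 0 := fun x ↦ by
    rw [hDapply, map_sub, hT, hT, ← Finset.sum_sub_distrib]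
    exact htel x
  have hDT : ∀ x, D (T x) = 0 := fun x ↦ by
    rw [hDapply, hT, map_sum, ← Finset.sum_sub_distrib]
    have : ∑ j ∈ range m, (φ (φ^[j] x) - φ^[j] x) = ∑ j ∈ range m, (φ^[j] (φ x) - φ^[j] x) :=
      Finset.sum_congr rfl fun j _ ↦ by rw [← iterate_succ_apply' φ j x, iterate_succ_apply]
    rw [this]
    exact htel x
  -- `range D ≤ ker T` and `range T ≤ ker D`
  have hDT' : AddMonoidHom.range D ≤ AddMonoidHom.ker T := by
    rintro _ ⟨x, rfl⟩
    exact (AddMonoidHom.mem_ker).mpr (hTD x)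
  have hTD' : AddMonoidHom.range T ≤ AddMonoidHom.ker D := by
    rintro _ ⟨x, rfl⟩
    exact (AddMonoidHom.mem_ker).mpr (hDT x)
  -- counting
  have hA1 : Nat.card A = Nat.card (AddMonoidHom.ker D) * Nat.card (AddMonoidHom.range D) := by
    rw [AddSubgroup.card_eq_card_quotient_mul_card_addSubgroup (AddMonoidHom.ker D), mul_comm,
      Nat.card_congr (QuotientAddGroup.quotientKerEquivRange D).toEquiv]
  have hA2 : Nat.card A = Nat.card (AddMonoidHom.ker T) * Nat.card (AddMonoidHom.range T) := by
    rw [AddSubgroup.card_eq_card_quotient_mul_card_addSubgroup (AddMonoidHom.ker T), mul_comm,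
      Nat.card_congr (QuotientAddGroup.quotientKerEquivRange T).toEquiv]
  set G := AddMonoidHom.ker T ⧸ (AddMonoidHom.range D).addSubgroupOf (AddMonoidHom.ker T) with hG
  have hG1 : Nat.card G * Nat.card (AddMonoidHom.range D) = Nat.card (AddMonoidHom.ker T) :=
    card_quotient_addSubgroupOf_mul_card hDT'
  have hpos : 0 < Nat.card (AddMonoidHom.range D) := Nat.card_pos
  have hdvd : Nat.card G ∣ Nat.card (AddMonoidHom.ker D) := by
    refine ⟨Nat.card (AddMonoidHom.range T), ?_⟩
    have h := hA1
    rw [hA2, ← hG1] at h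
    -- h : Nat.card G * Nat.card (range D) * Nat.card (range T) = Nat.card (ker D) * Nat.card (range D)
    have h' : (Nat.card G * Nat.card (AddMonoidHom.range T)) * Nat.card (AddMonoidHom.range D) =
        Nat.card (AddMonoidHom.ker D) * Nat.card (AddMonoidHom.range D) := by
      rw [← h]; ring
    exact (Nat.eq_of_mul_eq_mul_right hpos h').symm
  -- `a ∈ ker T`, and `(Nat.card G) • a ∈ range D`
  have haT : a ∈ AddMonoidHom.ker T := by rw [AddMonoidHom.mem_ker, hT]; exact hNa
  have hGa : Nat.card G • a ∈ AddMonoidHom.range D := by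
    have h0 : Nat.card G • (QuotientAddGroup.mk (s := (AddMonoidHom.range D).addSubgroupOf (AddMonoidHom.ker T))
        (⟨a, haT⟩ : AddMonoidHom.ker T) : G) = 0 := card_nsmul_eq_zero'
    rw [← QuotientAddGroup.mk_nsmul, QuotientAddGroup.eq_zero_iff, AddSubgroup.mem_addSubgroupOf] at h0
    exact h0
  obtain ⟨k, hk⟩ := hdvd
  rw [hk, mul_nsmul]
  exact AddSubgroup.nsmul_mem _ hGa k

end Summit.BirchSwinnertonDyer.BirchSwinnertonDyer.Theorems.MilneTamagawa
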